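import Mathlib
import HarnessLib

/-!
# Hardy–Littlewood–Chowla on average (Lichtman–Teräväinen 2022): growth lemmas for the parameters

Topic `Literature/NumberTheory/Sieve`, companion of `HardyLittlewoodChowla.lean` (the named facts
`lichtmanTeravainen2022_hlc_avg(_liouville)` = J. D. Lichtman, J. Teräväinen, *On the
Hardy–Littlewood–Chowla conjecture on average*, Forum Math. Sigma 10 (2022) e57, arXiv:2111.08912
[LichtmanTeravainen2022], Theorem 1.2 (i)).  Everything in this file is PROVED; it introduces no
definition and no named fact.

Elementary "for all sufficiently large `t`" inequalities between powers, logarithms and exponentials,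
in the explicit `∃ t₀, ∀ t ≥ t₀` form in which the assembly of Theorem 1.2 (i)
(`HardyLittlewoodChowlaProofs.lean`) consumes them to place the parameters
`H ∈ [(log X)^{ℓ+ε}, exp((log X)^a)]`, `V = (log H)^B`, `P₁ = V^{1000}`, `Q₁ = 2H/V^{15}` of §4 of the
paper in the regime of [MRT2015, Theorem 2.3] (held copy `paper:arxiv-2111.08912`, §4: "we take
`W = (log H)^{…}`, `P₁ = W^{200}`, `Q₁ = H/W³` … for `a = a(ε, ℓ)` small enough").  All from
Mathlib's `Real.isLittleO_pow_exp_atTop` and `Real.isLittleO_log_id_atTop`.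

## References

* J. D. Lichtman, J. Teräväinen, Forum Math. Sigma 10 (2022) e57, arXiv:2111.08912, §4.
  [cite: LichtmanTeravainen2022, §4]
-/

noncomputable section

open Filter Asymptotics

namespace Literature.NumberTheory.Sieve.LichtmanTeravainen2022

/-- `t^k ≤ c e^t` for `t ≥ t₀(k, c)`. [folklore] -/
theorem exists_pow_le_mul_exp (k : ℕ) {c : ℝ} (hc : 0 < c) :
    ∃ t₀ : ℝ, ∀ t : ℝ, t₀ ≤ t → t ^ k ≤ c * Real.exp t := by
  have h := (Real.isLittleO_pow_exp_atTop (n := k)).bound hc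
  rw [Filter.eventually_atTop] at h
  obtain ⟨t₀, ht₀⟩ := h
  refine ⟨max t₀ 0, fun t ht => ?_⟩
  have h1 := ht₀ t (le_trans (le_max_left _ _) ht)
  have ht0 : 0 ≤ t := le_trans (le_max_right _ _) ht
  rwa [Real.norm_of_nonneg (pow_nonneg ht0 _), Real.norm_of_nonneg (Real.exp_pos _).le] at h1

/-- `log t ≤ c t` for `t ≥ t₀(c)`. [folklore] -/
theorem exists_log_le_mul {c : ℝ} (hc : 0 < c) :
    ∃ t₀ : ℝ, ∀ t : ℝ, t₀ ≤ t → Real.log t ≤ c * t := by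
  have h := Real.isLittleO_log_id_atTop.bound hc
  rw [Filter.eventually_atTop] at h
  obtain ⟨t₀, ht₀⟩ := h
  refine ⟨max t₀ 0, fun t ht => ?_⟩
  have h1 := ht₀ t (le_trans (le_max_left _ _) ht)
  have ht0 : 0 ≤ t := le_trans (le_max_right _ _) ht
  rw [id, Real.norm_of_nonneg ht0] at h1
  exact (Real.le_norm_self _).trans h1

/-- `t^a ≤ √t ≤ t/2` for `t ≥ 4`, `a ≤ 1/2`. [folklore] -/
theorem rpow_le_half {a : ℝ} (ha : a ≤ 1 / 2) {t : ℝ} (ht : 4 ≤ t) : t ^ a ≤ t / 2 := by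
  have ht1 : (1 : ℝ) ≤ t := by linarith
  have h1 : t ^ a ≤ t ^ (1 / 2 : ℝ) := Real.rpow_le_rpow_of_exponent_le ht1 ha
  have h2 : t ^ (1 / 2 : ℝ) = Real.sqrt t := (Real.sqrt_eq_rpow t).symm
  have h3 : 2 ≤ Real.sqrt t := by
    rw [show (2 : ℝ) = Real.sqrt 4 by
      rw [show (4 : ℝ) = 2 ^ 2 by norm_num, Real.sqrt_sq (by norm_num)]]
    exact Real.sqrt_le_sqrt ht
  have h4 : Real.sqrt t * Real.sqrt t = t := Real.mul_self_sqrt (by linarith)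
  rw [h2] at h1
  nlinarith

/-- `exp(t^a) t^k ≤ c e^t` for `t ≥ t₀(a, k, c)` when `a ≤ 1/2`. [folklore] -/
theorem exists_exp_rpow_mul_pow_le {a : ℝ} (ha : a ≤ 1 / 2) (k : ℕ) {c : ℝ} (hc : 0 < c) :
    ∃ t₀ : ℝ, ∀ t : ℝ, t₀ ≤ t → Real.exp (t ^ a) * t ^ k ≤ c * Real.exp t := by
  obtain ⟨s₀, hs₀⟩ := exists_pow_le_mul_exp k (c := c / 2 ^ k) (by positivity)
  refine ⟨max (2 * s₀) 4, fun t ht => ?_⟩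
  have ht4 : 4 ≤ t := le_trans (le_max_right _ _) ht
  have hts : s₀ ≤ t / 2 := by have := le_trans (le_max_left _ _) ht; linarith
  have ht0 : 0 ≤ t := by linarith
  have h1 : Real.exp (t ^ a) ≤ Real.exp (t / 2) := Real.exp_le_exp.2 (rpow_le_half ha ht4)
  have h2 : t ^ k ≤ c * Real.exp (t / 2) := by
    have h := hs₀ (t / 2) hts
    have h2k : (0 : ℝ) < 2 ^ k := by positivity
    rw [div_pow, div_mul_eq_mul_div, le_div_iff₀ h2k] at h
    calc t ^ k = t ^ k / 2 ^ k * 2 ^ k := by field_simp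
      _ ≤ c * Real.exp (t / 2) := by linarith
  calc Real.exp (t ^ a) * t ^ k ≤ Real.exp (t / 2) * (c * Real.exp (t / 2)) :=
        mul_le_mul h1 h2 (pow_nonneg ht0 _) (Real.exp_pos _).le
    _ = c * Real.exp t := by
        rw [show Real.exp t = Real.exp (t / 2) * Real.exp (t / 2) by
          rw [← Real.exp_add]; ring_nf]
        ring

/-- `c + t^a ≤ √(t/2)` for `t ≥ t₀(a, c)` when `a ≤ 1/4`. [folklore] -/
theorem exists_add_rpow_le_sqrt_half {a : ℝ} (ha : a ≤ 1 / 4) (c : ℝ) :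
    ∃ t₀ : ℝ, ∀ t : ℝ, t₀ ≤ t → c + t ^ a ≤ Real.sqrt (t / 2) := by
  refine ⟨max 1 ((4 * (1 + |c|)) ^ 4), fun t ht => ?_⟩
  have ht1 : 1 ≤ t := le_trans (le_max_left _ _) ht
  have ht0 : 0 < t := by linarith
  set y : ℝ := t ^ (1 / 4 : ℝ) with hy
  have hy0 : 0 ≤ y := Real.rpow_nonneg ht0.le _
  have hy4 : y ^ 4 = t := by
    rw [hy, ← Real.rpow_natCast, ← Real.rpow_mul ht0.le]; norm_num
  have hybig : 4 * (1 + |c|) ≤ y := by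
    have h0 : 0 ≤ 4 * (1 + |c|) := by positivity
    have : (4 * (1 + |c|)) ^ 4 ≤ y ^ 4 := by rw [hy4]; exact le_trans (le_max_right _ _) ht
    exact le_of_pow_le_pow_left₀ (by norm_num) hy0 this
  have hy1 : 1 ≤ y := by have := abs_nonneg c; linarith
  have h1 : t ^ a ≤ y := by rw [hy]; exact Real.rpow_le_rpow_of_exponent_le ht1 ha
  have h2 : Real.sqrt (t / 2) = y ^ 2 / Real.sqrt 2 := by
    rw [Real.sqrt_div' _ zero_le_two, ← hy4, show y ^ 4 = (y ^ 2) ^ 2 by ring,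
      Real.sqrt_sq (by positivity)]
  have hs2 : Real.sqrt 2 ≤ 2 := by
    rw [show (2 : ℝ) = Real.sqrt 4 by
      rw [show (4 : ℝ) = 2 ^ 2 by norm_num, Real.sqrt_sq (by norm_num)]]
    exact Real.sqrt_le_sqrt (by norm_num)
  have hs0 : 0 < Real.sqrt 2 := Real.sqrt_pos.2 (by norm_num)
  have h3 : y ^ 2 / 2 ≤ y ^ 2 / Real.sqrt 2 :=
    div_le_div_of_nonneg_left (by positivity) hs0 hs2
  have hc : c ≤ |c| := le_abs_self c
  have hc0 : 0 ≤ |c| := abs_nonneg c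
  have h4 : |c| + y ≤ y ^ 2 / 2 := by
    have hy2 : 2 + 4 * |c| ≤ y - 2 := by linarith
    have : (2 + 4 * |c|) * y ≤ (y - 2) * y := mul_le_mul_of_nonneg_right hy2 hy0
    nlinarith
  rw [h2]
  linarith

/-- `√t ≤ t/4` for `t ≥ 16`. [folklore] -/
theorem sqrt_le_div_four {t : ℝ} (ht : 16 ≤ t) : Real.sqrt t ≤ t / 4 := by
  have h4 : 4 ≤ Real.sqrt t := by
    rw [show (4 : ℝ) = Real.sqrt 16 by
      rw [show (16 : ℝ) = 4 ^ 2 by norm_num, Real.sqrt_sq (by norm_num)]]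
    exact Real.sqrt_le_sqrt ht
  have h := Real.mul_self_sqrt (show (0 : ℝ) ≤ t by linarith)
  nlinarith

/-- `t ≤ e^{t/8}` for `t ≥ t₀`. [folklore] -/
theorem exists_le_exp_div_eight : ∃ t₀ : ℝ, ∀ t : ℝ, t₀ ≤ t → t ≤ Real.exp (t / 8) := by
  obtain ⟨s₀, hs₀⟩ := exists_pow_le_mul_exp 1 (c := 1 / 8) (by norm_num)
  refine ⟨8 * s₀, fun t ht => ?_⟩
  have := hs₀ (t / 8) (by linarith)
  rw [pow_one] at this
  linarith

/-- Thresholds of the form `c ≤ b log t`: they hold for `t ≥ exp(c/b)` (`b > 0`). [folklore] -/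
theorem le_mul_log_of_exp_le {b c t : ℝ} (hb : 0 < b) (ht : Real.exp (c / b) ≤ t) :
    c ≤ b * Real.log t := by
  have := Real.log_le_log (Real.exp_pos _) ht
  rw [Real.log_exp, div_le_iff₀ hb] at this
  linarith

end Literature.NumberTheory.Sieve.LichtmanTeravainen2022
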